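/-
Copyright (c) 2026 the pub-hodgecm-mathlib formalisation cell (harness21).  Prover seat hodgecm-mathlib-K2Liu-p12 (g3): Track B «K2-LIT»,
#184♮ = hLiu418 = stmt-HodgeConjecture-24832; #42S payer road, organ S1, ROAD W ramified hand, row (R-b2) letters (K2E5-p17 (g7) 2026-09-04T13:06:11Z «YES PLEASE»;
road-map owner K2Liu-p07 (g3) 13:05:32Z (2); LEAD F0P6-plan (g14) BATCH #16∕#18).
-/
import Literature.NumberTheory.GelbartRogawski1991.LocalDoubledBlockEmbedding                 -- ★ `blkLoc`, `blkLoc_apply`, `blkIdx`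
import Summits.HodgeConjecture.HodgeConjecture.Theorems.K2LiuLocalSWBigCellDecomposition        -- ★ F3c-A `adapt_matA_weylDelta` (+ `weylDelta`, `ofAdapted`)
import HarnessLib

/-!
# Crux `HLiu418`, organ S1, ROAD W (R-b2): FLIP ELEMENTS — the Weyl element flipping the lines of a projector, and the adapted matrix of `blkLoc (w_Δ^{T₁})`

Cell `hodgecm-mathlib`, crux item hLiu418 = `stmt-HodgeConjecture-24832`, route of record `HCCMUnconditional`; squad K2 ∕ K2Liu, road `K2_Liu`, #42S payer
road, organ S1, ROAD W; consumers K2E5-p17 (g7) ((Θ-1) of `K2LiuLocalSWTensorBlockFrame`: `Θ (tensorEmbLoc w₁) = blkLoc (w_Δ^{T₁})`), ★ F7r-2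
`K2LiuLocalSWRamifiedRankOneSign` (abstract flip `hx : adapt (matA x) = [[1 − P, P], [P, 1 − P]]`), ★ (R-a) `K2LiuLocalSWOffBigCellCases` (`hw₁` with `P = single i i 1`).
THEOREMS ONLY (no `def`, no `instance`, no `notation`, no named-fact hypothesis, no `sorry`); lane `--supports stmt-HodgeConjecture-24832` (count-neutral helper).

THE MATHEMATICS.  `H(L⁺_v) = U(T₀^𝔻)(L⁺_v)`, adapted frame `Y ↦ R Y R⁻¹` (★ `adapt`, `ofAdapted`, `adForm = antidiag(2𝕋, 2𝕋)`, `𝕋 = T₀ ⊗ 1`).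
* §1 (R-b2-i) **`exists_flip`**: for a projector `P` (`P² = P`) which is `σ`-hermitian (`(σP)ᵀ = P`) and commutes with `𝕋`, the matrix `Y = [[1 − P, P], [P, 1 − P]]` is an
  involution preserving `adForm` (`Y⋆ adForm Y = adForm` reduces to `P𝕋(1−P) + (1−P)𝕋P = 0`, `P𝕋P + (1−P)𝕋(1−P) = 𝕋`), so ★ `ofAdapted` gives `w₁ ∈ H(L⁺_v)` with
  `adapt (matA w₁) = Y`; **`exists_flip_single (i)`**: the instance `P = single i i 1` for DIAGONAL `T₀`.
* §2 (R-b2-ii) for the block datum `T = T₁ ⊕ᶠ T₂` and ★ `blkLoc : U(T₁^𝔻) →* U(T^𝔻)` (`h ↦ reindex blkIdx (h ⊕ 1)`): **`matA_blkLoc`** (`matA (blkLoc h)` is `fromBlocks (matA h) 0 0 1`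
  regrouped along `ρ : (V₁ ⊕ V₁⁻) ⊕ (V₂ ⊕ V₂⁻) ≃ (V₁ ⊕ V₂) ⊕ (V₁⁻ ⊕ V₂⁻)`), **`adapt_matA_blkLoc`** (the Cayley frame `R = [[1,1],[1,−1]]` regroups blockwise, so `adapt` commutes
  with the embedding), and **`adapt_matA_blkLoc_weylDelta : adapt (matA (blkLoc w_Δ^{T₁})) = [[1 − E, E], [E, 1 − E]]`**, `E = reindex (Fin n₁ ⊕ Fin n₂ ≃ Fin (n₁+n₂)) [[1,0],[0,0]]`
  the projector on `V₁` (★ `adapt_matA_weylDelta : adapt (matA w_Δ) = [[0,1],[1,0]]`) — the middle Weyl element IS a flip in §1's sense.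
HONEST LABEL.  Count-neutral helper; it retires nothing by itself: `HC_CM` is proved only modulo the 7 printed citations (2 remaining named inputs:
hLiu418 = `stmt-HodgeConjecture-24832`, h413 = `stmt-HodgeConjecture-24833`) until rung 0 closes.

## References
* [Kudla1994] S. Kudla, Israel J. Math. 87 (1994): §2 (doubled space, `V₁ ⊕ V₂`), §3 (adapted blocks, Weyl elements).
* [HarrisKudlaSweet1996] M. Harris, S. Kudla, W. J. Sweet, J. AMS 9 (1996): §1 (1.11), (1.15).   * [Kudla1984] S. Kudla, Invent. math. 78 (1984): §1 (see-saw embeddings).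
-/

set_option autoImplicit false
-- the mandated namespace repeats the single-problem summit's segment (`HodgeConjecture.HodgeConjecture`)
set_option linter.dupNamespace false

noncomputable section

open scoped Matrix
open NumberField IsDedekindDomain Matrix
open Literature.NumberTheory.Automorphic Literature.NumberTheory.Automorphic.UnitaryGroup
open Literature.NumberTheory.GelbartRogawski1991.AdaptedBlocks
open Literature.NumberTheory.GelbartRogawski1991.UnitaryDualPair.LocalSplitting
open Literature.NumberTheory.GelbartRogawski1991.UnitaryDualPair.LocalSplitting.DoubledBlock
open Summit.HodgeConjecture.HodgeConjecture.Cruxes.HLiu418.K2LiuLocalSWBigCellDecomposition (adapt_matA_weylDelta)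

namespace Summit.HodgeConjecture.HodgeConjecture.Cruxes.HLiu418.K2LiuLocalSWFlipElements

variable (F : Type) [Field F] [NumberField F] (E : Type) [Field E] [NumberField E] [Algebra F E] (c : E ≃ₐ[F] E)
  (v : HeightOneSpectrum (𝓞 F))

/-! ## §1 (R-b2-i) The flip of a projector is an element of `H(L⁺_v)` -/

section Flip

variable (n : ℕ) {T₀ : Matrix (Fin n) (Fin n) F} {JD : Matrix (Fin (n + n)) (Fin (n + n)) E} (hJD : JD = (gramD F n T₀).map (algebraMap F E))

include hJD in
/-- **THE FLIP OF A PROJECTOR (R-b2-i)**: for `P² = P`, `(σP)ᵀ = P`, `P𝕋 = 𝕋P` there is `w₁ ∈ H(L⁺_v)` with adapted matrix `[[1 − P, P], [P, 1 − P]]` (★ `ofAdapted`;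
`Y² = 1`, `Y⋆·antidiag(2𝕋,2𝕋)·Y = antidiag(2𝕋,2𝕋)`).  For `P = 1` this is `w_Δ`, for `P` a coordinate projector of rank one the middle Weyl element.
[cite: Kudla1994, §3] [cite: HarrisKudlaSweet1996, §1 (1.15)] -/
theorem exists_flip {P : Matrix (Fin n) (Fin n) (LocalRing E v)} (hP : P * P = P) (hPσ : (P.map (conjLocal E c v))ᵀ = P)
    (hPT : P * gramS F E v n T₀ = gramS F E v n T₀ * P) :
    ∃ w₁ : UnitaryGroup.localPi E c (n + n) JD v, adapt (matA F E c v n w₁) = Matrix.fromBlocks (1 - P) P P (1 - P) := by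
  have h1 : (1 - P) * (1 - P) = 1 - P := by rw [sub_mul, one_mul, mul_sub, mul_one, hP, sub_self, sub_zero]
  have h2 : (1 - P) * P = 0 := by rw [sub_mul, one_mul, hP, sub_self]
  have h3 : P * (1 - P) = 0 := by rw [mul_sub, mul_one, hP, sub_self]
  -- `Y² = 1`
  have hYY : Matrix.fromBlocks (1 - P) P P (1 - P) * Matrix.fromBlocks (1 - P) P P (1 - P) = 1 := by
    rw [Matrix.fromBlocks_multiply, h1, h2, h3, hP, ← Matrix.fromBlocks_one]
    congr 1 <;> abel
  have hYu : IsUnit (Matrix.fromBlocks (1 - P) P P (1 - P)).det := Matrix.isUnit_det_of_right_inverse hYY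
  -- `Y⋆ = Y`
  have h1σ : ((1 - P).map (conjLocal E c v))ᵀ = 1 - P := by
    rw [Matrix.map_sub _ (map_sub (conjLocal E c v)), Matrix.map_one _ (map_zero _) (map_one _), Matrix.transpose_sub, Matrix.transpose_one, hPσ]
  have hYσ : ((Matrix.fromBlocks (1 - P) P P (1 - P)).map (conjLocal E c v))ᵀ = Matrix.fromBlocks (1 - P) P P (1 - P) := by
    rw [Matrix.fromBlocks_map, Matrix.fromBlocks_transpose, h1σ, hPσ]
  -- `P` commutes with `2𝕋`
  have hPS : P * ((2 : LocalRing E v) • gramS F E v n T₀) = ((2 : LocalRing E v) • gramS F E v n T₀) * P := by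
    rw [Matrix.mul_smul, Matrix.smul_mul, hPT]
  have hQS : (1 - P) * ((2 : LocalRing E v) • gramS F E v n T₀) = ((2 : LocalRing E v) • gramS F E v n T₀) * (1 - P) := by
    rw [sub_mul, one_mul, mul_sub, mul_one, hPS]
  have hY : ((Matrix.fromBlocks (1 - P) P P (1 - P)).map (conjLocal E c v))ᵀ * adForm F E v n (T₀ := T₀) * Matrix.fromBlocks (1 - P) P P (1 - P) =
      adForm F E v n (T₀ := T₀) := by
    rw [hYσ, adForm, Matrix.fromBlocks_multiply]
    simp only [Matrix.mul_zero, zero_add, add_zero]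
    rw [Matrix.fromBlocks_multiply, hPS, hQS]
    simp only [Matrix.mul_assoc, h1, h2, h3, hP, Matrix.mul_zero, add_zero, ← Matrix.mul_add]
    rw [show P + (1 - P) = 1 by abel, show (1 - P) + P = 1 by abel, Matrix.mul_one]
  exact ⟨ofAdapted F E c v n hJD _ hYu hY, adapt_matA_ofAdapted F E c v n hJD _ hYu hY⟩

include hJD in
/-- **THE FLIP OF THE LINE `i` (R-b2-i)** for a DIAGONAL `T₀`: `∃ w₁ ∈ H(L⁺_v)`, `adapt (matA w₁) = [[1 − E_ii, E_ii], [E_ii, 1 − E_ii]]` — the `hw₁`∕`hx` letter of ★ (R-a)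
`offBigCell_cases` and ★ F7r-2. [cite: Kudla1994, §3] [cite: HarrisKudlaSweet1996, §1 (1.15)] -/
theorem exists_flip_single (t : Fin n → F) (hT₀ : T₀ = Matrix.diagonal t) (i : Fin n) :
    ∃ w₁ : UnitaryGroup.localPi E c (n + n) JD v, adapt (matA F E c v n w₁) =
      Matrix.fromBlocks (1 - Matrix.single i i 1) (Matrix.single i i 1) (Matrix.single i i 1) (1 - Matrix.single i i 1) := by
  refine exists_flip F E c v n hJD ?_ ?_ ?_
  · rw [Matrix.single_mul_single_same, mul_one]
  · refine Matrix.ext fun a b => ?_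
    simp only [Matrix.transpose_apply, Matrix.map_apply, Matrix.single, Matrix.of_apply]
    by_cases h : i = b ∧ i = a
    · rw [if_pos h, if_pos ⟨h.2, h.1⟩, map_one]
    · rw [if_neg h, if_neg (fun h' => h ⟨h'.2, h'.1⟩), map_zero]
  · -- `E_ii` commutes with the diagonal `𝕋`
    have hdiag : ∀ a b : Fin n, a ≠ b → gramS F E v n T₀ a b = 0 := fun a b hab => by
      simp only [gramS, hT₀, Matrix.map_apply, Matrix.diagonal_apply_ne _ hab, map_zero]
    refine Matrix.ext fun a b => ?_
    by_cases ha : a = i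
    · subst ha
      rw [Matrix.single_mul_apply_same, one_mul]
      by_cases hb : b = a
      · subst hb; rw [Matrix.mul_single_apply_same, mul_one]
      · rw [Matrix.mul_single_apply_of_ne (hbj := hb), hdiag _ _ (Ne.symm hb)]
    · rw [Matrix.single_mul_apply_of_ne (h := ha)]
      by_cases hb : b = i
      · subst hb; rw [Matrix.mul_single_apply_same, hdiag _ _ ha, zero_mul]
      · rw [Matrix.mul_single_apply_of_ne (hbj := hb)]

end Flip

/-! ## §2 (R-b2-ii) The adapted matrix of `blkLoc h` and of the middle Weyl element `blkLoc (w_Δ^{T₁})` -/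

section Block

variable (n₁ n₂ : ℕ) {T₁ : Matrix (Fin n₁) (Fin n₁) F} {T₂ : Matrix (Fin n₂) (Fin n₂) F}
  {JD₁ : Matrix (Fin (n₁ + n₁)) (Fin (n₁ + n₁)) E} (hJD₁ : JD₁ = (gramD F n₁ T₁).map (algebraMap F E))
  {JD : Matrix (Fin ((n₁ + n₂) + (n₁ + n₂))) (Fin ((n₁ + n₂) + (n₁ + n₂))) E}
  (hJD : JD = (gramD F (n₁ + n₂) (UnitaryGroup.finSum n₁ n₂ T₁ T₂)).map (algebraMap F E))

/-- **`matS (blkLoc h) = reindex blkIdx (matS h ⊕ 1)`** (★ `blkLoc_apply`, placewise). [cite: Kudla1984, §1] -/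
theorem matS_blkLoc (h : UnitaryGroup.localPi E c (n₁ + n₁) JD₁ v) :
    matS F E c v (n₁ + n₂) (blkLoc F E c v n₁ n₂ hJD₁ hJD h) =
      Matrix.reindex (blkIdx n₁ n₂) (blkIdx n₁ n₂) (Matrix.fromBlocks (matS F E c v n₁ h) 0 0 1) := by
  refine Matrix.ext fun a b => funext fun w => ?_
  have hl := congrFun (congrFun (coe_component_eq_matS_map F E c v (n₁ + n₂) (blkLoc F E c v n₁ n₂ hJD₁ hJD h) w) a) b
  rw [Matrix.map_apply, Pi.evalRingHom_apply] at hl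
  have hr : (Matrix.reindex (blkIdx n₁ n₂) (blkIdx n₁ n₂) (Matrix.fromBlocks (matS F E c v n₁ h) 0 0 1)) a b w =
      ((Matrix.reindex (blkIdx n₁ n₂) (blkIdx n₁ n₂) (Matrix.fromBlocks (matS F E c v n₁ h) 0 0 1)).map
        (Pi.evalRingHom (fun w : PlacesOver E v => w.1.adicCompletion E) w)) a b := rfl
  rw [← hl, hr, blkLoc_apply, UnitaryGroup.coe_reindexGL, UnitaryGroup.coe_blockDiagGL, Units.val_one, coe_component_eq_matS_map,
    Matrix.reindex_apply, Matrix.reindex_apply, ← Matrix.submatrix_map, Matrix.fromBlocks_map, Matrix.map_zero _ (map_zero _),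
    Matrix.map_zero _ (map_zero _), Matrix.map_one _ (map_zero _) (map_one _)]

/-- the index shuffle `blkIdx` read through `e₂`: `blkIdx⁻¹ ∘ e₂ = (e₂ ⊕ e₂) ∘ ρ⁻¹`, `ρ = sumSumSumComm ≫ (⊕ᶠ ⊕ ⊕ᶠ)`. [cite: Kudla1994, §2] -/
theorem blkIdx_symm_e₂ (x : Fin (n₁ + n₂) ⊕ Fin (n₁ + n₂)) :
    (blkIdx n₁ n₂).symm (e₂ (n₁ + n₂) x) = Sum.map (e₂ n₁) (e₂ n₂)
      (((Equiv.sumSumSumComm (Fin n₁) (Fin n₁) (Fin n₂) (Fin n₂)).trans (finSumFinEquiv.sumCongr finSumFinEquiv)).symm x) := by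
  rcases x with x | x <;> obtain ⟨y, rfl⟩ := finSumFinEquiv.surjective x <;> rcases y with i | j
  · rw [blkIdx_symm_inl_inl]; simp [Equiv.sumSumSumComm]
  · rw [blkIdx_symm_inl_inr]; simp [Equiv.sumSumSumComm]
  · rw [blkIdx_symm_inr_inl]; simp [Equiv.sumSumSumComm]
  · rw [blkIdx_symm_inr_inr]; simp [Equiv.sumSumSumComm]

/-- **`matA (blkLoc h)` is `matA h ⊕ 1` regrouped** along `ρ = sumSumSumComm ≫ (⊕ᶠ ⊕ ⊕ᶠ) : (V₁ ⊕ V₁⁻) ⊕ (V₂ ⊕ V₂⁻) ≃ (V₁ ⊕ V₂) ⊕ (V₁⁻ ⊕ V₂⁻)`. [cite: Kudla1994, §2] -/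
theorem matA_blkLoc (h : UnitaryGroup.localPi E c (n₁ + n₁) JD₁ v) :
    matA F E c v (n₁ + n₂) (blkLoc F E c v n₁ n₂ hJD₁ hJD h) =
      Matrix.reindex ((Equiv.sumSumSumComm (Fin n₁) (Fin n₁) (Fin n₂) (Fin n₂)).trans (finSumFinEquiv.sumCongr finSumFinEquiv))
        ((Equiv.sumSumSumComm (Fin n₁) (Fin n₁) (Fin n₂) (Fin n₂)).trans (finSumFinEquiv.sumCongr finSumFinEquiv))
        (Matrix.fromBlocks (matA F E c v n₁ h) 0 0 1) := by
  have hblk : ∀ p q : (Fin n₁ ⊕ Fin n₁) ⊕ (Fin n₂ ⊕ Fin n₂),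
      (Matrix.fromBlocks (matS F E c v n₁ h) 0 0 (1 : Matrix (Fin (n₂ + n₂)) (Fin (n₂ + n₂)) (LocalRing E v))) (Sum.map (e₂ n₁) (e₂ n₂) p) (Sum.map (e₂ n₁) (e₂ n₂) q) =
        (Matrix.fromBlocks (matA F E c v n₁ h) 0 0 1) p q := by
    intro p q
    rcases p with p | p <;> rcases q with q | q <;>
      simp [matA, Matrix.reindex_apply, Matrix.submatrix_apply, Matrix.one_apply, (e₂ n₂).injective.eq_iff]
  rw [matA, matS_blkLoc]
  refine Matrix.ext fun a b => ?_
  rw [Matrix.reindex_apply, Matrix.reindex_apply, Matrix.reindex_apply, Matrix.submatrix_apply, Matrix.submatrix_apply, Matrix.submatrix_apply,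
    Equiv.symm_symm, blkIdx_symm_e₂, blkIdx_symm_e₂, hblk]

/-- the two summands of `Fin n₁ ⊕ Fin n₂ ≃ Fin (n₁ + n₂)` are disjoint. [folklore] -/
theorem castAdd_ne_natAdd (x : Fin n₁) (y : Fin n₂) : Fin.castAdd n₂ x ≠ Fin.natAdd n₁ y := by
  intro h
  have h' := congrArg Fin.val h
  simp only [Fin.val_castAdd, Fin.val_natAdd] at h'
  omega

/-- the two summands of `Fin n₁ ⊕ Fin n₂ ≃ Fin (n₁ + n₂)` are disjoint. [folklore] -/
theorem natAdd_ne_castAdd (x : Fin n₂) (y : Fin n₁) : Fin.natAdd n₁ x ≠ Fin.castAdd n₂ y := fun h => castAdd_ne_natAdd n₁ n₂ y x h.symm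

omit [NumberField F] in
/-- **the Cayley frame regroups blockwise**: `reindex ρ (cayR_{n₁} ⊕ cayR_{n₂}) = cayR_{n₁+n₂}` (each block of `cayR = [[1,1],[1,−1]]` is scalar). [cite: Kudla1994, §3] -/
theorem reindex_fromBlocks_cayR :
    Matrix.reindex ((Equiv.sumSumSumComm (Fin n₁) (Fin n₁) (Fin n₂) (Fin n₂)).trans (finSumFinEquiv.sumCongr finSumFinEquiv))
        ((Equiv.sumSumSumComm (Fin n₁) (Fin n₁) (Fin n₂) (Fin n₂)).trans (finSumFinEquiv.sumCongr finSumFinEquiv))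
        (Matrix.fromBlocks (cayR (LocalRing E v) (Fin n₁)) 0 0 (cayR (LocalRing E v) (Fin n₂))) = cayR (LocalRing E v) (Fin (n₁ + n₂)) := by
  refine Matrix.ext fun a b => ?_
  rw [Matrix.reindex_apply, Matrix.submatrix_apply]
  rcases a with a | a <;> rcases b with b | b <;>
    obtain ⟨x, rfl⟩ := finSumFinEquiv.surjective a <;> obtain ⟨y, rfl⟩ := finSumFinEquiv.surjective b <;>
      rcases x with x | x <;> rcases y with y | y <;>
        simp [cayR, Equiv.sumSumSumComm, Matrix.fromBlocks, Matrix.one_apply, castAdd_ne_natAdd, natAdd_ne_castAdd]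

/-- **`adapt` COMMUTES WITH THE BLOCK EMBEDDING**: `adapt (matA (blkLoc h)) = reindex ρ (adapt (matA h) ⊕ 1)`. [cite: Kudla1994, §3] -/
theorem adapt_matA_blkLoc (h : UnitaryGroup.localPi E c (n₁ + n₁) JD₁ v) :
    adapt (matA F E c v (n₁ + n₂) (blkLoc F E c v n₁ n₂ hJD₁ hJD h)) =
      Matrix.reindex ((Equiv.sumSumSumComm (Fin n₁) (Fin n₁) (Fin n₂) (Fin n₂)).trans (finSumFinEquiv.sumCongr finSumFinEquiv))
        ((Equiv.sumSumSumComm (Fin n₁) (Fin n₁) (Fin n₂) (Fin n₂)).trans (finSumFinEquiv.sumCongr finSumFinEquiv))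
        (Matrix.fromBlocks (adapt (matA F E c v n₁ h)) 0 0 1) := by
  have hR := reindex_fromBlocks_cayR F E v n₁ n₂
  have hRinv : Matrix.reindex ((Equiv.sumSumSumComm (Fin n₁) (Fin n₁) (Fin n₂) (Fin n₂)).trans (finSumFinEquiv.sumCongr finSumFinEquiv))
        ((Equiv.sumSumSumComm (Fin n₁) (Fin n₁) (Fin n₂) (Fin n₂)).trans (finSumFinEquiv.sumCongr finSumFinEquiv))
        (Matrix.fromBlocks (cayRinv (LocalRing E v) (Fin n₁)) 0 0 (cayRinv (LocalRing E v) (Fin n₂))) = cayRinv (LocalRing E v) (Fin (n₁ + n₂)) := by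
    rw [cayRinv, cayRinv, cayRinv, ← hR, show Matrix.fromBlocks (⅟(2 : LocalRing E v) • cayR (LocalRing E v) (Fin n₁)) 0 0 (⅟(2 : LocalRing E v) • cayR (LocalRing E v) (Fin n₂)) =
        ⅟(2 : LocalRing E v) • Matrix.fromBlocks (cayR (LocalRing E v) (Fin n₁)) 0 0 (cayR (LocalRing E v) (Fin n₂)) by simp only [Matrix.fromBlocks_smul, smul_zero],
      Matrix.reindex_apply, Matrix.reindex_apply, Matrix.submatrix_smul]
    rfl
  rw [adapt, matA_blkLoc, ← hR, ← hRinv, Matrix.reindex_apply, Matrix.reindex_apply, Matrix.reindex_apply, Matrix.reindex_apply,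
    Matrix.submatrix_mul_equiv, Matrix.submatrix_mul_equiv, Matrix.fromBlocks_multiply, Matrix.fromBlocks_multiply]
  simp only [Matrix.mul_zero, Matrix.zero_mul, add_zero, zero_add, Matrix.mul_one, cayRinv_mul_cayR, adapt]

/-- **THE MIDDLE WEYL ELEMENT IS A FLIP (R-b2-ii)**: `adapt (matA (blkLoc (w_Δ^{T₁}))) = [[1 − E, E], [E, 1 − E]]` with `E` the coordinate projector on `V₁ ⊂ V₁ ⊕ V₂`
(`E = reindex (Fin n₁ ⊕ Fin n₂ ≃ Fin (n₁+n₂)) [[1,0],[0,0]]`; ★ `adapt_matA_weylDelta : adapt (matA w_Δ) = [[0,1],[1,0]]`). [cite: Kudla1994, §3] [cite: Kudla1984, §1] -/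
theorem adapt_matA_blkLoc_weylDelta :
    adapt (matA F E c v (n₁ + n₂) (blkLoc F E c v n₁ n₂ hJD₁ hJD (weylDelta F E c v n₁ hJD₁ (T₀ := T₁)))) =
      Matrix.fromBlocks
        (1 - Matrix.reindex finSumFinEquiv finSumFinEquiv (Matrix.fromBlocks (1 : Matrix (Fin n₁) (Fin n₁) (LocalRing E v)) 0 0 (0 : Matrix (Fin n₂) (Fin n₂) (LocalRing E v))))
        (Matrix.reindex finSumFinEquiv finSumFinEquiv (Matrix.fromBlocks (1 : Matrix (Fin n₁) (Fin n₁) (LocalRing E v)) 0 0 (0 : Matrix (Fin n₂) (Fin n₂) (LocalRing E v))))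
        (Matrix.reindex finSumFinEquiv finSumFinEquiv (Matrix.fromBlocks (1 : Matrix (Fin n₁) (Fin n₁) (LocalRing E v)) 0 0 (0 : Matrix (Fin n₂) (Fin n₂) (LocalRing E v))))
        (1 - Matrix.reindex finSumFinEquiv finSumFinEquiv (Matrix.fromBlocks (1 : Matrix (Fin n₁) (Fin n₁) (LocalRing E v)) 0 0 (0 : Matrix (Fin n₂) (Fin n₂) (LocalRing E v)))) := by
  rw [adapt_matA_blkLoc, adapt_matA_weylDelta]
  refine Matrix.ext fun a b => ?_
  rw [Matrix.reindex_apply, Matrix.submatrix_apply]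
  rcases a with a | a <;> rcases b with b | b <;>
    obtain ⟨x, rfl⟩ := finSumFinEquiv.surjective a <;> obtain ⟨y, rfl⟩ := finSumFinEquiv.surjective b <;>
      rcases x with x | x <;> rcases y with y | y <;>
        simp [Equiv.sumSumSumComm, Matrix.fromBlocks, Matrix.one_apply, castAdd_ne_natAdd, natAdd_ne_castAdd]

end Block

end Summit.HodgeConjecture.HodgeConjecture.Cruxes.HLiu418.K2LiuLocalSWFlipElements

end
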